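/-
Copyright (c) 2026 the pub-hodgecm-mathlib formalisation cell (harness21).  Prover seat hodgecm-mathlib-LH7-p10 (g3), req620 Track A «(D-RAM) FOUR-FRAME» squad
((β₂) road (R-36) «PURE-CELL LEDGER», lane C = type RamM: the band cut of the (OFF_C) residue of ★ p863855 `offRowC_holds_of_lines₂` — the odd-`d` CORNER ‹hCorner› of the `m = 4b` row from its RAY and MIX bands), 2026-09-05.
-/
import Summits.HodgeConjecture.HodgeConjecture.Theorems.F0P3cDyRamBeta2ConesOffRowCOfLinesTwo     -- ★ p863855 (this lineage, g2): the consumer `offRowC_holds_of_lines₂ (N) (hN) (hTopLo) (hLow) (hCorner)`; brings every token of ‹OFF_C.letter.v2›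
import HarnessLib

/-!
# Crux `H413`, line LH4 «(D-RAM) FOUR-FRAME» — STAGE-1b, row (2) of `f_{T₊}`, the (β₂) road «PURE-CELL LEDGER» (R-36), LANE C (type RamM, `|jE ϖ| = exp(−2)`,
# `|α − ρα| = exp(−d_ρ)`): THE CORNER RESIDUAL LETTER ‹hCorner› OF ★ p863855 `offRowC_holds_of_lines₂` FROM ITS RAY AND MIX BANDS

Cell `hodgecm-mathlib` (D-0151), FLOOR 0, crux item H413 = `stmt-HodgeConjecture-24833`, route of record `HCCMUnconditional`; squads F0∕P3c∕LH4 ∕ LH7; lane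
`--supports stmt-HodgeConjecture-24833 --as helper` (count-neutral; pays NO tier-0 row).  THEOREMS ONLY (no `def`, no instance, no notation, no `sorry`, default heartbeats);
★-only imports; states NO law; the two band letters, ‹ROW_C› and (β₂) stay HYPOTHESES.  ONE literal in ★ p861305 §3's general-block spelling, LANE-C block
(‹OFF_C.letter.v2› a2c0234d7b04450d, `F0/P3c/LH7/LH7-p10/g2/OFF_C.letter.v2.LH7p10g2.lean.txt`, lines 4–50 BYTE FOR BYTE = ★ p863855's blocks).

WHAT (this seat's SIG `F0/P3c/LH7/LH7-p10/g3/LANEC-RESIDUE.sig.v1.LH7p10g3.md` 482ff8c4 §1∕§3; the lane-B model is ★ p863936 `…Beta2ConesOffRowDiagOfBands.offRowD_of_bands` in shape (lane B has NO twin CELL: `m ≡ d (mod 2)` kills the row `2b = m` at odd `d` there)).  ★ p863855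
`…Beta2ConesOffRowCOfLinesTwo.offRowC_holds_of_lines₂ (N) (hN : ∀ d t, 2·m_c(d) ≤ N d t) (hTopLo) (hLow) (hCorner) : ‹OFF_C.letter.v2›` leaves three residual letters; THIS FILE
assembles its `hCorner` binder (odd `d`, the row `m = 4b` (`m_E = 2b`, NOT lane C's live row `4b + 2 = m`) AT its anti-diagonal corner `jl = 2j + d_ρ + 2b` (`jl_E = j + b`), `1 ≤ b ≤ j`, ‹live›, `lam ∈ 𝒪_j` ⟹ `cellDiff(j, b) = 0`) from TWO BAND LETTERS that differ by ONE ℕ-inequality inserted immediately before `IsOrd ρ α (jE ϖ ^ j) lam`: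
the RAY band `mstarOfRecord d ≤ b` and the MIX band `b < mstarOfRecord d`.  WHY THIS CUT (SIG §1): under ★ p863549's unit bridge (`m = 2m_E`, `jl = 2jl_E + d_ρ`; ★ `exists_jl_eq_two_mul_add`,
★ `v_mu_eq_pow`, ★ PAR_C p863632) the RamM cone cell `(j, b)` carries lane B's geometry with `(m, jl) ↦ (m_E, jl_E)`; RAY DOMINATION at the modulus `m⋆ = mstarOfRecord d`
(★ p861653 `…NormFormRayDominated.normFormSet_eq_ray_of_isOrd`, datum-free letters `μ = jE(ϖ^{m′})·μ̃`, `μ̃ ∈ 𝒪_cc`, `m⋆ ≤ m′`) holds in lane C iff `m⋆ ≤ jl_E − j` (★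
`…RayLettersTokensRamM.exists_isOrd_of_coords`: `m⋆ ≤ v_E(μ_a)` ⟸ the floor, `m⋆ + j ≤ jl_E`) — the SAME inequality as lane B's band `m⋆ ≤ jl − j` (★ p863048's `hmm`); on this
cell `jl_E − j = b`, so the RAY band reads `mstarOfRecord d ≤ b` in the letter's own currency.  The RAY band is the digit engine's (lane B: LH4-p19 (g3) R1∕R2, to be ported in `v_M` units);
the MIX band needs the RamM twin of the trace-ideal ray structure (lane B: ★ p863638 → p863761 → p863829 → p863923; NOT in tree for `|jE ·| = |·|²`).  Conclusion = ★ p863855's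
`hCorner` binder VERBATIM, so `offRowC_holds_of_lines₂ N hN hTopLo hLow (offRowCC_of_bands N hC_ray hC_mix)` elaborates (kernel probe by paste in the cand folder).  Proof: `intro` the block and the cell, `le_or_gt` on the band.
HONEST LABEL.  Count-neutral closure; nothing printed is asserted; no census law is stated; the band letters, ‹hTopLo›∕‹hLow›∕‹hCorner›'s siblings, (ROW_C) and (β₂) stay
HYPOTHESES (β₂ UNPROVED); `HC_CM` is proved only modulo the 7 printed citations (2 remaining named inputs: hLiu418 = `stmt-HodgeConjecture-24832`, h413 =
`stmt-HodgeConjecture-24833`) until rung 0 closes.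
## References
* [Kottwitz1986BaseChangeUnits] R. E. Kottwitz, *Base change for unit elements of Hecke algebras*, Compositio Math. 60 (1986): §1 pp. 240–241 (signed lattice counts, cell by cell).
* [Jacobowitz1962] R. Jacobowitz, *Hermitian forms over local fields*, Amer. J. Math. 84 (1962): §4 (hermitian lattices over orders; Gram-primitivity).
* [Rogawski1990] J. Rogawski, *Automorphic Representations of Unitary Groups in Three Variables*, Ann. of Math. Stud. 123 (1990): §4.9 Prop. 4.9.1 (b) p. 55.
* [Serre1979] J.-P. Serre, *Local Fields*, GTM 67 (1979): Ch. III §6 Prop. 12 (orders of conductor `c`).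
-/

set_option autoImplicit false

noncomputable section

namespace Summit.HodgeConjecture.HodgeConjecture.Cruxes.H413.F0P3cDyRamBeta2ConesOffRowCCornerOfBands

open scoped Valued WithZero Matrix MatrixGroups Pointwise Classical
open WithZero
open Literature.NumberTheory.Automorphic Literature.NumberTheory.Automorphic.HermitianLattice Literature.NumberTheory.Automorphic.UnitaryLatticeTree
open Literature.NumberTheory.Automorphic.UnitaryGroup
open Literature.NumberTheory.Automorphic.UnitaryThreeFourFrame (IsRamifiedQuadraticDatum)
open Literature.NumberTheory.Rogawski1990
open Summit.HodgeConjecture.HodgeConjecture.Cruxes.H413.F0P3cDyRamFourFramePieces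
open Summit.HodgeConjecture.HodgeConjecture.Cruxes.H413.F0P3cDyRamFourFrameCensusDefs (LatticeInLevel LatticeNearTransvShell)
open Summit.HodgeConjecture.HodgeConjecture.Cruxes.H413.F0P3cDyRamStageOneBDefs (mcOfRecord)
open Summit.HodgeConjecture.HodgeConjecture.Cruxes.H413.F0P3cDyRamToricCensusDefs

/-- **THE RESIDUAL LETTER `‹hCorner›` OF ★ `offRowC_holds_of_lines₂`, FROM ITS RAY AND MIX BANDS (lane C).**  Binders: `N : ℕ → ℕ → ℕ` (the schema parameter of
‹OFF_C›), then the two band letters `hC_ray` (`mstarOfRecord d ≤ b`) and `hC_mix` (`b < mstarOfRecord d`), each = ★ p863855's `hCorner` binder with the band premise inserted immediately before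
`IsOrd ρ α (jE ϖ ^ j) lam`; conclusion = that binder VERBATIM.  Proof: `le_or_gt (mstarOfRecord d) b`. [cite: Kottwitz1986BaseChangeUnits, §1 pp. 240–241] [cite: Jacobowitz1962, §4]
[cite: Rogawski1990, §4.9 Prop. 4.9.1 (b) p. 55] -/
theorem offRowCC_of_bands (N : ℕ → ℕ → ℕ)
    (hC_ray :
      ∀ (E M : Type) [Field E] [Valued E ℤᵐ⁰] [CompleteSpace E] [IsDiscreteValuationRing 𝒪[E]] [Finite 𝓀[E]]
        [Field M] [Valued M ℤᵐ⁰] [CompleteSpace M] [IsDiscreteValuationRing 𝒪[M]] [Finite 𝓀[M]]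
        (σ : E →+* E) (ϖ : E) (d tE : ℕ) (_hD : IsRamifiedQuadraticDatum σ ϖ d tE) (_hσσ : ∀ a, σ (σ a) = a) (_h2 : ¬ IsUnit (2 : 𝒪[E]))
        (jE : E →+* M) (ρ Θ : M →+* M) (α lam : M)
        (_hρρ : ∀ z, ρ (ρ z) = z) (_hvρ : ∀ z, Valued.v (ρ z) = Valued.v z) (_hρj : ∀ a, ρ (jE a) = jE a)
        (_hjv : ∀ a, Valued.v (jE a) ≤ 1 ↔ Valued.v a ≤ 1) (_hjfix : ∀ z : M, ρ z = z ↔ ∃ a, jE a = z) (_hΘj : ∀ a, Θ (jE a) = jE (σ a))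
        (_hΘΘ : ∀ z, Θ (Θ z) = z) (_hΘρ : ∀ z, Θ (ρ z) = ρ (Θ z)) (_hvΘ : ∀ z, Valued.v (Θ z) = Valued.v z)
        (_hα : ρ α ≠ α) (_hα1 : Valued.v α ≤ 1) (_hint : ∀ z : M, Valued.v z ≤ 1 → Valued.v ((z - ρ z) / (α - ρ α)) ≤ 1)
        (_hΘlam : Θ lam * lam = 1) (_hvlam : Valued.v lam = 1) (_hbasis : ∀ z : M, ∃! pq : E × E, z = jE pq.1 + jE pq.2 * lam)
        (_hC : Valued.v (α - ρ α) < 1) (ϖM c₀ n₀ : M) (dρ dΘ dτ g s0 dK d' : ℕ)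
        (_c1 : ∀ a, Valued.v (jE a) = Valued.v a ^ 2) (_c2 : Nat.card 𝓀[M] = Nat.card 𝓀[E]) (_c3 : ∀ z : M, Valued.v z ≤ 1 → Valued.v (z - Θ z) < 1) (_c4 : ∀ z : M, Valued.v z ≤ 1 → Valued.v (z - Θ (ρ z)) < 1)
        (_c5 : Valued.v ϖM = WithZero.exp (-1 : ℤ)) (_c6 : α - ρ α = ϖM - ρ ϖM) (_c7 : IsRamifiedQuadraticDatum ρ ϖM dρ (2 * tE)) (_c8 : IsRamifiedQuadraticDatum Θ ϖM dΘ (2 * tE)) (_c9 : 1 ≤ dτ)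
        (_c10 : Valued.v (ϖM - Θ (ρ ϖM)) = Valued.v ϖM ^ dτ) (_c11 : Θ c₀ = c₀) (_c12 : Valued.v c₀ = 1) (_c13 : ∀ x : M, Θ x = x → Valued.v x = 1 → (∃ z : M, z * Θ z = x) ∨ ∃ z : M, z * Θ z = c₀ * x)
        (_c14 : ∀ f₀ : M, ρ f₀ = f₀ → Θ f₀ = f₀ → Valued.v f₀ = 1 → ∃ z : M, z * Θ z = f₀) (_c15 : Θ n₀ = n₀) (_c16 : Valued.v n₀ = 1) (_c17 : ¬ ∃ z : M, z * Θ z = n₀)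
        (_c18 : ∀ x : M, ρ x = x → Θ (ρ x) = x → x ≠ 0 → ∃ n : ℤ, Valued.v x = WithZero.exp (4 * n)) (_c19 : ∀ z : M, ρ z = z → Θ z = z → z ≠ 0 → ∃ n : ℤ, Valued.v z = WithZero.exp (4 * n))
        (_c20 : ∃ a : M, Θ a = a ∧ Valued.v a = 1 ∧ ¬ ∃ e : M, ρ e = e ∧ e * Θ e = a * ρ a) (_c21 : dΘ = 2 * g) (_c22 : dτ = 2 * s0) (_c23 : 1 ≤ g) (_c24 : 1 ≤ s0) (_c25 : g + s0 = d)
        (_c26 : Valued.v (ϖM * Θ (ρ ϖM) - ρ (ϖM * Θ (ρ ϖM))) = WithZero.exp (-(2 * (dK : ℤ)))) (_c27 : 2 * dK = dρ + 2 * g)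
        (_c28 : Valued.v (ϖM * Θ ϖM - ρ (ϖM * Θ ϖM)) = WithZero.exp (-(2 * (d' : ℤ)))) (_c29 : 2 * d' = dρ + dτ) (_hjpow : ∀ (t : E) (n : ℤ), Valued.v (jE t) = Valued.v (jE ϖ) ^ n ↔ Valued.v t = Valued.v ϖ ^ n)
        (_hEval : ∀ c : M, ρ c = c → c ≠ 0 → Valued.v c ≤ 1 → ∃ n : ℕ, Valued.v c = Valued.v (jE ϖ) ^ n)
        (_hϖmax : ∀ t : M, ρ t = t → Valued.v t < 1 → Valued.v t ≤ Valued.v (jE ϖ))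
        (γ₂ : GL (Fin 2) E) (u : GL (Fin 1) E)
        (_hdet : (γ₂ : Matrix (Fin 2) (Fin 2) E).det * σ (γ₂ : Matrix (Fin 2) (Fin 2) E).det = 1)
        (_htr : (γ₂ : Matrix (Fin 2) (Fin 2) E).trace = (γ₂ : Matrix (Fin 2) (Fin 2) E).det * σ (γ₂ : Matrix (Fin 2) (Fin 2) E).trace)
        (_hirr : ∀ x : E, x * x - (γ₂ : Matrix (Fin 2) (Fin 2) E).trace * x + (γ₂ : Matrix (Fin 2) (Fin 2) E).det ≠ 0)
        (_hlam2 : lam * lam = jE (γ₂ : Matrix (Fin 2) (Fin 2) E).trace * lam - jE (γ₂ : Matrix (Fin 2) (Fin 2) E).det)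
        (_hρlam : ρ lam = jE (γ₂ : Matrix (Fin 2) (Fin 2) E).trace - lam) (m jl : ℕ) (_hm : Valued.v (lam - jE ((u : Matrix (Fin 1) (Fin 1) E) 0 0)) = WithZero.exp (-(m : ℤ)))
        (_hjl : Valued.v ((lam - jE ((u : Matrix (Fin 1) (Fin 1) E) 0 0)) - ρ (lam - jE ((u : Matrix (Fin 1) (Fin 1) E) 0 0))) = WithZero.exp (-(jl : ℤ)))
        (_hs : Valued.v ((γ₂ : Matrix (Fin 2) (Fin 2) E).trace - 2) * Valued.v (ϖ ^ (d % 2)) ≤ Valued.v (ϖ ^ mcOfRecord d))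
        (_hp : Valued.v ((γ₂ : Matrix (Fin 2) (Fin 2) E).det - (γ₂ : Matrix (Fin 2) (Fin 2) E).trace + 1) ≤ Valued.v (ϖ ^ mcOfRecord d))
        (_hNm : N d tE ≤ m) (_hu1N : Valued.v (((u : Matrix (Fin 1) (Fin 1) E) 0 0) - 1) ≤ Valued.v (ϖ ^ N d tE)) (_hlam1 : Valued.v (lam - 1) ≤ Valued.v (jE ϖ ^ N d tE))
        (_hu : Valued.v ((u : Matrix (Fin 1) (Fin 1) E) 0 0) = 1) (_hum : Valued.v (((u : Matrix (Fin 1) (Fin 1) E) 0 0) - 1) ≤ Valued.v (ϖ ^ mstarOfRecord d))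
        (H₂ : Matrix (Fin 2) (Fin 2) E) (hW : E) (_hH₂ : IsUnit H₂.det) (_hH₂σ : (H₂.map σ)ᵀ = H₂) (_hhW : Valued.v hW = 1) (_hhWσ : σ hW = hW)
        (P₁ : GL (Fin 3) E) (_hA : formCongr σ P₁ ((StdForm.antidiagonal 3).over E) = (!![H₂ 0 0, 0, H₂ 0 1; 0, hW, 0; H₂ 1 0, 0, H₂ 1 1] : Matrix (Fin 3) (Fin 3) E))
        (_hΓ : P₁ * endoGL (γ₂, u) * P₁⁻¹ ∈ unitaryGroupOfForm σ ((StdForm.antidiagonal 3).over E))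
        (φ : (Fin 2 → E) →+ M) (h : M) (_hφs : ∀ (c : E) (x : Fin 2 → E), φ (c • x) = jE c * φ x) (_hφi : Function.Injective φ) (_hφo : Function.Surjective φ)
        (_hφγ : ∀ x, φ ((γ₂ : Matrix (Fin 2) (Fin 2) E).mulVec x) = lam * φ x)
        (_hform : ∀ x y, jE (pairing σ H₂ x y) = h * Θ (φ x) * φ y + ρ (h * Θ (φ x) * φ y)) (_hΘh : Θ h = h) (_hh : h ≠ 0)
        (J R : ℕ) (f : ℕ → ℕ → AddSubgroup M → ℕ)
        (_hfinF : {L₃ : Submodule 𝒪[E] (Fin 3 → E) | IsSelfDualLattice σ ϖ (!![H₂ 0 0, 0, H₂ 0 1; 0, hW, 0; H₂ 1 0, 0, H₂ 1 1] : Matrix (Fin 3) (Fin 3) E) L₃ ∧ mapGL (endoGL (γ₂, u)) L₃ = L₃}.Finite)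
        (_hR : ∀ L₃ : Submodule 𝒪[E] (Fin 3 → E), IsSelfDualLattice σ ϖ (!![H₂ 0 0, 0, H₂ 0 1; 0, hW, 0; H₂ 1 0, 0, H₂ 1 1] : Matrix (Fin 3) (Fin 3) E) L₃ →
          mapGL (endoGL (γ₂, u)) L₃ = L₃ → ∀ b : ℕ, (∀ c : E, (Pi.single 1 c : Fin 3 → E) ∈ L₃ ↔ Valued.v c ≤ Valued.v ϖ ^ b) → b ≤ R)
        (_hJ : ¬ IsOrd ρ α (jE ϖ ^ (J + 1)) lam) (_hfinLS : ∀ j a, (levelSet ρ Θ α (jE ϖ) h j a).Finite)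
        (_hf : ∀ (b j : ℕ) (Λ : AddSubgroup M) (x₀ : M) (r : E), 1 ≤ b → x₀ ≠ 0 → (∀ x, x ∈ Λ ↔ ∃ z, IsOrd ρ α (jE ϖ ^ j) z ∧ x = x₀ * z) →
          IsOrd ρ α (jE ϖ ^ j) (dualGen ρ Θ α (jE ϖ ^ j) h x₀) → ¬ IsOrd ρ α (jE ϖ ^ j) (dualGen ρ Θ α (jE ϖ ^ j) h x₀ / jE ϖ) → Valued.v (dualGen ρ Θ α (jE ϖ ^ j) h x₀) = Valued.v (jE ϖ) ^ b →
          (∀ b', (∀ x ∈ Λ, Valued.v (h * Θ x * b' + ρ (h * Θ x * b')) ≤ 1) → (lam - jE ((u : Matrix (Fin 1) (Fin 1) E) 0 0)) * b' ∈ Λ) → IsOrd ρ α (jE ϖ ^ j) lam →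
          jE r = glueUnit ρ Θ α (jE ϖ ^ j) h (jE ϖ) (jE hW) x₀ b →
          f b j Λ = Nat.card {x : 𝒪[E] ⧸ 𝓂[E] ^ (2 * b) // ∃ u' : 𝒪[E], Ideal.Quotient.mk (𝓂[E] ^ (2 * b)) u' = x ∧ Valued.v ((u' : E) * σ u' - r) ≤ Valued.v (ϖ ^ (2 * b))}),
        ∀ j b : ℕ, 1 ≤ b → b ≤ j → d % 2 = 1 → m = 4 * b → jl = 2 * j + dρ + 2 * b → (j + 1 = b + s0 ∨ (b + s0 ≤ j ∧ (j - b - s0) % 2 = 0)) → mstarOfRecord d ≤ b → IsOrd ρ α (jE ϖ ^ j) lam →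
                ((∑ᶠ Λ ∈ levelSetDep ρ Θ α (jE ϖ) h j b (lam - jE ((u : Matrix (Fin 1) (Fin 1) E) 0 0)) ∩
                      {Λ | ∃ B : Submodule 𝒪[E] (Fin 2 → E), B.toAddSubgroup.map φ = Λ ∧
                        ∃ L₃ : Submodule 𝒪[E] (Fin 3 → E), IsSelfDualLattice σ ϖ (!![H₂ 0 0, 0, H₂ 0 1; 0, hW, 0; H₂ 1 0, 0, H₂ 1 1] : Matrix (Fin 3) (Fin 3) E) L₃ ∧
                          L₃ ⊓ LinearMap.ker ((LinearMap.proj (1 : Fin 3) : (Fin 3 → E) →ₗ[E] E).restrictScalars 𝒪[E]) =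
                            B.map ((Matrix.toLin' (!![1, 0; 0, 0; 0, 1] : Matrix (Fin 3) (Fin 2) E)).restrictScalars 𝒪[E]) ∧
                          (∀ c : E, (Pi.single 1 c : Fin 3 → E) ∈ L₃ ↔ Valued.v c ≤ Valued.v ϖ ^ b) ∧
                          (LatticeNearTransvShell ϖ (d % 2) (mstarOfRecord d) ((((endoGL (γ₂, u) : GL (Fin 3) E) : Matrix (Fin 3) (Fin 3) E) - 1)) L₃ ∧
                            {z : E | ∃ y ∈ L₃, Valued.v ((ϖ ^ (mstarOfRecord d))⁻¹ * (z - pairing σ (!![H₂ 0 0, 0, H₂ 0 1; 0, hW, 0; H₂ 1 0, 0, H₂ 1 1] : Matrix (Fin 3) (Fin 3) E) y (((((endoGL (γ₂, u) : GL (Fin 3) E) : Matrix (Fin 3) (Fin 3) E) - 1)) *ᵥ y))) ≤ 1} =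
                              valueSetMod σ ϖ (mstarOfRecord d) (xPlus σ ϖ d))}, f b j Λ : ℕ) : ℤ) -
                  ((∑ᶠ Λ ∈ levelSetDep ρ Θ α (jE ϖ) h j b (lam - jE ((u : Matrix (Fin 1) (Fin 1) E) 0 0)) ∩
                      {Λ | ∃ B : Submodule 𝒪[E] (Fin 2 → E), B.toAddSubgroup.map φ = Λ ∧
                        ∃ L₃ : Submodule 𝒪[E] (Fin 3 → E), IsSelfDualLattice σ ϖ (!![H₂ 0 0, 0, H₂ 0 1; 0, hW, 0; H₂ 1 0, 0, H₂ 1 1] : Matrix (Fin 3) (Fin 3) E) L₃ ∧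
                          L₃ ⊓ LinearMap.ker ((LinearMap.proj (1 : Fin 3) : (Fin 3 → E) →ₗ[E] E).restrictScalars 𝒪[E]) =
                            B.map ((Matrix.toLin' (!![1, 0; 0, 0; 0, 1] : Matrix (Fin 3) (Fin 2) E)).restrictScalars 𝒪[E]) ∧
                          (∀ c : E, (Pi.single 1 c : Fin 3 → E) ∈ L₃ ↔ Valued.v c ≤ Valued.v ϖ ^ b) ∧
                          (LatticeNearTransvShell ϖ (d % 2) (mcOfRecord d) ((((endoGL (γ₂, u) : GL (Fin 3) E) : Matrix (Fin 3) (Fin 3) E) - 1)) L₃ ∧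
                            ¬ {z : E | ∃ y ∈ L₃, Valued.v ((ϖ ^ (mstarOfRecord d))⁻¹ * (z - pairing σ (!![H₂ 0 0, 0, H₂ 0 1; 0, hW, 0; H₂ 1 0, 0, H₂ 1 1] : Matrix (Fin 3) (Fin 3) E) y (((((endoGL (γ₂, u) : GL (Fin 3) E) : Matrix (Fin 3) (Fin 3) E) - 1)) *ᵥ y))) ≤ 1} =
                              valueSetMod σ ϖ (mstarOfRecord d) (xPlus σ ϖ d))}, f b j Λ : ℕ) : ℤ) = 0)
    (hC_mix :
      ∀ (E M : Type) [Field E] [Valued E ℤᵐ⁰] [CompleteSpace E] [IsDiscreteValuationRing 𝒪[E]] [Finite 𝓀[E]]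
        [Field M] [Valued M ℤᵐ⁰] [CompleteSpace M] [IsDiscreteValuationRing 𝒪[M]] [Finite 𝓀[M]]
        (σ : E →+* E) (ϖ : E) (d tE : ℕ) (_hD : IsRamifiedQuadraticDatum σ ϖ d tE) (_hσσ : ∀ a, σ (σ a) = a) (_h2 : ¬ IsUnit (2 : 𝒪[E]))
        (jE : E →+* M) (ρ Θ : M →+* M) (α lam : M)
        (_hρρ : ∀ z, ρ (ρ z) = z) (_hvρ : ∀ z, Valued.v (ρ z) = Valued.v z) (_hρj : ∀ a, ρ (jE a) = jE a)
        (_hjv : ∀ a, Valued.v (jE a) ≤ 1 ↔ Valued.v a ≤ 1) (_hjfix : ∀ z : M, ρ z = z ↔ ∃ a, jE a = z) (_hΘj : ∀ a, Θ (jE a) = jE (σ a))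
        (_hΘΘ : ∀ z, Θ (Θ z) = z) (_hΘρ : ∀ z, Θ (ρ z) = ρ (Θ z)) (_hvΘ : ∀ z, Valued.v (Θ z) = Valued.v z)
        (_hα : ρ α ≠ α) (_hα1 : Valued.v α ≤ 1) (_hint : ∀ z : M, Valued.v z ≤ 1 → Valued.v ((z - ρ z) / (α - ρ α)) ≤ 1)
        (_hΘlam : Θ lam * lam = 1) (_hvlam : Valued.v lam = 1) (_hbasis : ∀ z : M, ∃! pq : E × E, z = jE pq.1 + jE pq.2 * lam)
        (_hC : Valued.v (α - ρ α) < 1) (ϖM c₀ n₀ : M) (dρ dΘ dτ g s0 dK d' : ℕ)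
        (_c1 : ∀ a, Valued.v (jE a) = Valued.v a ^ 2) (_c2 : Nat.card 𝓀[M] = Nat.card 𝓀[E]) (_c3 : ∀ z : M, Valued.v z ≤ 1 → Valued.v (z - Θ z) < 1) (_c4 : ∀ z : M, Valued.v z ≤ 1 → Valued.v (z - Θ (ρ z)) < 1)
        (_c5 : Valued.v ϖM = WithZero.exp (-1 : ℤ)) (_c6 : α - ρ α = ϖM - ρ ϖM) (_c7 : IsRamifiedQuadraticDatum ρ ϖM dρ (2 * tE)) (_c8 : IsRamifiedQuadraticDatum Θ ϖM dΘ (2 * tE)) (_c9 : 1 ≤ dτ)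
        (_c10 : Valued.v (ϖM - Θ (ρ ϖM)) = Valued.v ϖM ^ dτ) (_c11 : Θ c₀ = c₀) (_c12 : Valued.v c₀ = 1) (_c13 : ∀ x : M, Θ x = x → Valued.v x = 1 → (∃ z : M, z * Θ z = x) ∨ ∃ z : M, z * Θ z = c₀ * x)
        (_c14 : ∀ f₀ : M, ρ f₀ = f₀ → Θ f₀ = f₀ → Valued.v f₀ = 1 → ∃ z : M, z * Θ z = f₀) (_c15 : Θ n₀ = n₀) (_c16 : Valued.v n₀ = 1) (_c17 : ¬ ∃ z : M, z * Θ z = n₀)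
        (_c18 : ∀ x : M, ρ x = x → Θ (ρ x) = x → x ≠ 0 → ∃ n : ℤ, Valued.v x = WithZero.exp (4 * n)) (_c19 : ∀ z : M, ρ z = z → Θ z = z → z ≠ 0 → ∃ n : ℤ, Valued.v z = WithZero.exp (4 * n))
        (_c20 : ∃ a : M, Θ a = a ∧ Valued.v a = 1 ∧ ¬ ∃ e : M, ρ e = e ∧ e * Θ e = a * ρ a) (_c21 : dΘ = 2 * g) (_c22 : dτ = 2 * s0) (_c23 : 1 ≤ g) (_c24 : 1 ≤ s0) (_c25 : g + s0 = d)
        (_c26 : Valued.v (ϖM * Θ (ρ ϖM) - ρ (ϖM * Θ (ρ ϖM))) = WithZero.exp (-(2 * (dK : ℤ)))) (_c27 : 2 * dK = dρ + 2 * g)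
        (_c28 : Valued.v (ϖM * Θ ϖM - ρ (ϖM * Θ ϖM)) = WithZero.exp (-(2 * (d' : ℤ)))) (_c29 : 2 * d' = dρ + dτ) (_hjpow : ∀ (t : E) (n : ℤ), Valued.v (jE t) = Valued.v (jE ϖ) ^ n ↔ Valued.v t = Valued.v ϖ ^ n)
        (_hEval : ∀ c : M, ρ c = c → c ≠ 0 → Valued.v c ≤ 1 → ∃ n : ℕ, Valued.v c = Valued.v (jE ϖ) ^ n)
        (_hϖmax : ∀ t : M, ρ t = t → Valued.v t < 1 → Valued.v t ≤ Valued.v (jE ϖ))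
        (γ₂ : GL (Fin 2) E) (u : GL (Fin 1) E)
        (_hdet : (γ₂ : Matrix (Fin 2) (Fin 2) E).det * σ (γ₂ : Matrix (Fin 2) (Fin 2) E).det = 1)
        (_htr : (γ₂ : Matrix (Fin 2) (Fin 2) E).trace = (γ₂ : Matrix (Fin 2) (Fin 2) E).det * σ (γ₂ : Matrix (Fin 2) (Fin 2) E).trace)
        (_hirr : ∀ x : E, x * x - (γ₂ : Matrix (Fin 2) (Fin 2) E).trace * x + (γ₂ : Matrix (Fin 2) (Fin 2) E).det ≠ 0)
        (_hlam2 : lam * lam = jE (γ₂ : Matrix (Fin 2) (Fin 2) E).trace * lam - jE (γ₂ : Matrix (Fin 2) (Fin 2) E).det)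
        (_hρlam : ρ lam = jE (γ₂ : Matrix (Fin 2) (Fin 2) E).trace - lam) (m jl : ℕ) (_hm : Valued.v (lam - jE ((u : Matrix (Fin 1) (Fin 1) E) 0 0)) = WithZero.exp (-(m : ℤ)))
        (_hjl : Valued.v ((lam - jE ((u : Matrix (Fin 1) (Fin 1) E) 0 0)) - ρ (lam - jE ((u : Matrix (Fin 1) (Fin 1) E) 0 0))) = WithZero.exp (-(jl : ℤ)))
        (_hs : Valued.v ((γ₂ : Matrix (Fin 2) (Fin 2) E).trace - 2) * Valued.v (ϖ ^ (d % 2)) ≤ Valued.v (ϖ ^ mcOfRecord d))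
        (_hp : Valued.v ((γ₂ : Matrix (Fin 2) (Fin 2) E).det - (γ₂ : Matrix (Fin 2) (Fin 2) E).trace + 1) ≤ Valued.v (ϖ ^ mcOfRecord d))
        (_hNm : N d tE ≤ m) (_hu1N : Valued.v (((u : Matrix (Fin 1) (Fin 1) E) 0 0) - 1) ≤ Valued.v (ϖ ^ N d tE)) (_hlam1 : Valued.v (lam - 1) ≤ Valued.v (jE ϖ ^ N d tE))
        (_hu : Valued.v ((u : Matrix (Fin 1) (Fin 1) E) 0 0) = 1) (_hum : Valued.v (((u : Matrix (Fin 1) (Fin 1) E) 0 0) - 1) ≤ Valued.v (ϖ ^ mstarOfRecord d))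
        (H₂ : Matrix (Fin 2) (Fin 2) E) (hW : E) (_hH₂ : IsUnit H₂.det) (_hH₂σ : (H₂.map σ)ᵀ = H₂) (_hhW : Valued.v hW = 1) (_hhWσ : σ hW = hW)
        (P₁ : GL (Fin 3) E) (_hA : formCongr σ P₁ ((StdForm.antidiagonal 3).over E) = (!![H₂ 0 0, 0, H₂ 0 1; 0, hW, 0; H₂ 1 0, 0, H₂ 1 1] : Matrix (Fin 3) (Fin 3) E))
        (_hΓ : P₁ * endoGL (γ₂, u) * P₁⁻¹ ∈ unitaryGroupOfForm σ ((StdForm.antidiagonal 3).over E))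
        (φ : (Fin 2 → E) →+ M) (h : M) (_hφs : ∀ (c : E) (x : Fin 2 → E), φ (c • x) = jE c * φ x) (_hφi : Function.Injective φ) (_hφo : Function.Surjective φ)
        (_hφγ : ∀ x, φ ((γ₂ : Matrix (Fin 2) (Fin 2) E).mulVec x) = lam * φ x)
        (_hform : ∀ x y, jE (pairing σ H₂ x y) = h * Θ (φ x) * φ y + ρ (h * Θ (φ x) * φ y)) (_hΘh : Θ h = h) (_hh : h ≠ 0)
        (J R : ℕ) (f : ℕ → ℕ → AddSubgroup M → ℕ)
        (_hfinF : {L₃ : Submodule 𝒪[E] (Fin 3 → E) | IsSelfDualLattice σ ϖ (!![H₂ 0 0, 0, H₂ 0 1; 0, hW, 0; H₂ 1 0, 0, H₂ 1 1] : Matrix (Fin 3) (Fin 3) E) L₃ ∧ mapGL (endoGL (γ₂, u)) L₃ = L₃}.Finite)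
        (_hR : ∀ L₃ : Submodule 𝒪[E] (Fin 3 → E), IsSelfDualLattice σ ϖ (!![H₂ 0 0, 0, H₂ 0 1; 0, hW, 0; H₂ 1 0, 0, H₂ 1 1] : Matrix (Fin 3) (Fin 3) E) L₃ →
          mapGL (endoGL (γ₂, u)) L₃ = L₃ → ∀ b : ℕ, (∀ c : E, (Pi.single 1 c : Fin 3 → E) ∈ L₃ ↔ Valued.v c ≤ Valued.v ϖ ^ b) → b ≤ R)
        (_hJ : ¬ IsOrd ρ α (jE ϖ ^ (J + 1)) lam) (_hfinLS : ∀ j a, (levelSet ρ Θ α (jE ϖ) h j a).Finite)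
        (_hf : ∀ (b j : ℕ) (Λ : AddSubgroup M) (x₀ : M) (r : E), 1 ≤ b → x₀ ≠ 0 → (∀ x, x ∈ Λ ↔ ∃ z, IsOrd ρ α (jE ϖ ^ j) z ∧ x = x₀ * z) →
          IsOrd ρ α (jE ϖ ^ j) (dualGen ρ Θ α (jE ϖ ^ j) h x₀) → ¬ IsOrd ρ α (jE ϖ ^ j) (dualGen ρ Θ α (jE ϖ ^ j) h x₀ / jE ϖ) → Valued.v (dualGen ρ Θ α (jE ϖ ^ j) h x₀) = Valued.v (jE ϖ) ^ b →
          (∀ b', (∀ x ∈ Λ, Valued.v (h * Θ x * b' + ρ (h * Θ x * b')) ≤ 1) → (lam - jE ((u : Matrix (Fin 1) (Fin 1) E) 0 0)) * b' ∈ Λ) → IsOrd ρ α (jE ϖ ^ j) lam →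
          jE r = glueUnit ρ Θ α (jE ϖ ^ j) h (jE ϖ) (jE hW) x₀ b →
          f b j Λ = Nat.card {x : 𝒪[E] ⧸ 𝓂[E] ^ (2 * b) // ∃ u' : 𝒪[E], Ideal.Quotient.mk (𝓂[E] ^ (2 * b)) u' = x ∧ Valued.v ((u' : E) * σ u' - r) ≤ Valued.v (ϖ ^ (2 * b))}),
        ∀ j b : ℕ, 1 ≤ b → b ≤ j → d % 2 = 1 → m = 4 * b → jl = 2 * j + dρ + 2 * b → (j + 1 = b + s0 ∨ (b + s0 ≤ j ∧ (j - b - s0) % 2 = 0)) → b < mstarOfRecord d → IsOrd ρ α (jE ϖ ^ j) lam →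
                ((∑ᶠ Λ ∈ levelSetDep ρ Θ α (jE ϖ) h j b (lam - jE ((u : Matrix (Fin 1) (Fin 1) E) 0 0)) ∩
                      {Λ | ∃ B : Submodule 𝒪[E] (Fin 2 → E), B.toAddSubgroup.map φ = Λ ∧
                        ∃ L₃ : Submodule 𝒪[E] (Fin 3 → E), IsSelfDualLattice σ ϖ (!![H₂ 0 0, 0, H₂ 0 1; 0, hW, 0; H₂ 1 0, 0, H₂ 1 1] : Matrix (Fin 3) (Fin 3) E) L₃ ∧
                          L₃ ⊓ LinearMap.ker ((LinearMap.proj (1 : Fin 3) : (Fin 3 → E) →ₗ[E] E).restrictScalars 𝒪[E]) =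
                            B.map ((Matrix.toLin' (!![1, 0; 0, 0; 0, 1] : Matrix (Fin 3) (Fin 2) E)).restrictScalars 𝒪[E]) ∧
                          (∀ c : E, (Pi.single 1 c : Fin 3 → E) ∈ L₃ ↔ Valued.v c ≤ Valued.v ϖ ^ b) ∧
                          (LatticeNearTransvShell ϖ (d % 2) (mstarOfRecord d) ((((endoGL (γ₂, u) : GL (Fin 3) E) : Matrix (Fin 3) (Fin 3) E) - 1)) L₃ ∧
                            {z : E | ∃ y ∈ L₃, Valued.v ((ϖ ^ (mstarOfRecord d))⁻¹ * (z - pairing σ (!![H₂ 0 0, 0, H₂ 0 1; 0, hW, 0; H₂ 1 0, 0, H₂ 1 1] : Matrix (Fin 3) (Fin 3) E) y (((((endoGL (γ₂, u) : GL (Fin 3) E) : Matrix (Fin 3) (Fin 3) E) - 1)) *ᵥ y))) ≤ 1} =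
                              valueSetMod σ ϖ (mstarOfRecord d) (xPlus σ ϖ d))}, f b j Λ : ℕ) : ℤ) -
                  ((∑ᶠ Λ ∈ levelSetDep ρ Θ α (jE ϖ) h j b (lam - jE ((u : Matrix (Fin 1) (Fin 1) E) 0 0)) ∩
                      {Λ | ∃ B : Submodule 𝒪[E] (Fin 2 → E), B.toAddSubgroup.map φ = Λ ∧
                        ∃ L₃ : Submodule 𝒪[E] (Fin 3 → E), IsSelfDualLattice σ ϖ (!![H₂ 0 0, 0, H₂ 0 1; 0, hW, 0; H₂ 1 0, 0, H₂ 1 1] : Matrix (Fin 3) (Fin 3) E) L₃ ∧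
                          L₃ ⊓ LinearMap.ker ((LinearMap.proj (1 : Fin 3) : (Fin 3 → E) →ₗ[E] E).restrictScalars 𝒪[E]) =
                            B.map ((Matrix.toLin' (!![1, 0; 0, 0; 0, 1] : Matrix (Fin 3) (Fin 2) E)).restrictScalars 𝒪[E]) ∧
                          (∀ c : E, (Pi.single 1 c : Fin 3 → E) ∈ L₃ ↔ Valued.v c ≤ Valued.v ϖ ^ b) ∧
                          (LatticeNearTransvShell ϖ (d % 2) (mcOfRecord d) ((((endoGL (γ₂, u) : GL (Fin 3) E) : Matrix (Fin 3) (Fin 3) E) - 1)) L₃ ∧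
                            ¬ {z : E | ∃ y ∈ L₃, Valued.v ((ϖ ^ (mstarOfRecord d))⁻¹ * (z - pairing σ (!![H₂ 0 0, 0, H₂ 0 1; 0, hW, 0; H₂ 1 0, 0, H₂ 1 1] : Matrix (Fin 3) (Fin 3) E) y (((((endoGL (γ₂, u) : GL (Fin 3) E) : Matrix (Fin 3) (Fin 3) E) - 1)) *ᵥ y))) ≤ 1} =
                              valueSetMod σ ϖ (mstarOfRecord d) (xPlus σ ϖ d))}, f b j Λ : ℕ) : ℤ) = 0) :
      ∀ (E M : Type) [Field E] [Valued E ℤᵐ⁰] [CompleteSpace E] [IsDiscreteValuationRing 𝒪[E]] [Finite 𝓀[E]]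
        [Field M] [Valued M ℤᵐ⁰] [CompleteSpace M] [IsDiscreteValuationRing 𝒪[M]] [Finite 𝓀[M]]
        (σ : E →+* E) (ϖ : E) (d tE : ℕ) (_hD : IsRamifiedQuadraticDatum σ ϖ d tE) (_hσσ : ∀ a, σ (σ a) = a) (_h2 : ¬ IsUnit (2 : 𝒪[E]))
        (jE : E →+* M) (ρ Θ : M →+* M) (α lam : M)
        (_hρρ : ∀ z, ρ (ρ z) = z) (_hvρ : ∀ z, Valued.v (ρ z) = Valued.v z) (_hρj : ∀ a, ρ (jE a) = jE a)
        (_hjv : ∀ a, Valued.v (jE a) ≤ 1 ↔ Valued.v a ≤ 1) (_hjfix : ∀ z : M, ρ z = z ↔ ∃ a, jE a = z) (_hΘj : ∀ a, Θ (jE a) = jE (σ a))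
        (_hΘΘ : ∀ z, Θ (Θ z) = z) (_hΘρ : ∀ z, Θ (ρ z) = ρ (Θ z)) (_hvΘ : ∀ z, Valued.v (Θ z) = Valued.v z)
        (_hα : ρ α ≠ α) (_hα1 : Valued.v α ≤ 1) (_hint : ∀ z : M, Valued.v z ≤ 1 → Valued.v ((z - ρ z) / (α - ρ α)) ≤ 1)
        (_hΘlam : Θ lam * lam = 1) (_hvlam : Valued.v lam = 1) (_hbasis : ∀ z : M, ∃! pq : E × E, z = jE pq.1 + jE pq.2 * lam)
        (_hC : Valued.v (α - ρ α) < 1) (ϖM c₀ n₀ : M) (dρ dΘ dτ g s0 dK d' : ℕ)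
        (_c1 : ∀ a, Valued.v (jE a) = Valued.v a ^ 2) (_c2 : Nat.card 𝓀[M] = Nat.card 𝓀[E]) (_c3 : ∀ z : M, Valued.v z ≤ 1 → Valued.v (z - Θ z) < 1) (_c4 : ∀ z : M, Valued.v z ≤ 1 → Valued.v (z - Θ (ρ z)) < 1)
        (_c5 : Valued.v ϖM = WithZero.exp (-1 : ℤ)) (_c6 : α - ρ α = ϖM - ρ ϖM) (_c7 : IsRamifiedQuadraticDatum ρ ϖM dρ (2 * tE)) (_c8 : IsRamifiedQuadraticDatum Θ ϖM dΘ (2 * tE)) (_c9 : 1 ≤ dτ)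
        (_c10 : Valued.v (ϖM - Θ (ρ ϖM)) = Valued.v ϖM ^ dτ) (_c11 : Θ c₀ = c₀) (_c12 : Valued.v c₀ = 1) (_c13 : ∀ x : M, Θ x = x → Valued.v x = 1 → (∃ z : M, z * Θ z = x) ∨ ∃ z : M, z * Θ z = c₀ * x)
        (_c14 : ∀ f₀ : M, ρ f₀ = f₀ → Θ f₀ = f₀ → Valued.v f₀ = 1 → ∃ z : M, z * Θ z = f₀) (_c15 : Θ n₀ = n₀) (_c16 : Valued.v n₀ = 1) (_c17 : ¬ ∃ z : M, z * Θ z = n₀)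
        (_c18 : ∀ x : M, ρ x = x → Θ (ρ x) = x → x ≠ 0 → ∃ n : ℤ, Valued.v x = WithZero.exp (4 * n)) (_c19 : ∀ z : M, ρ z = z → Θ z = z → z ≠ 0 → ∃ n : ℤ, Valued.v z = WithZero.exp (4 * n))
        (_c20 : ∃ a : M, Θ a = a ∧ Valued.v a = 1 ∧ ¬ ∃ e : M, ρ e = e ∧ e * Θ e = a * ρ a) (_c21 : dΘ = 2 * g) (_c22 : dτ = 2 * s0) (_c23 : 1 ≤ g) (_c24 : 1 ≤ s0) (_c25 : g + s0 = d)
        (_c26 : Valued.v (ϖM * Θ (ρ ϖM) - ρ (ϖM * Θ (ρ ϖM))) = WithZero.exp (-(2 * (dK : ℤ)))) (_c27 : 2 * dK = dρ + 2 * g)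
        (_c28 : Valued.v (ϖM * Θ ϖM - ρ (ϖM * Θ ϖM)) = WithZero.exp (-(2 * (d' : ℤ)))) (_c29 : 2 * d' = dρ + dτ) (_hjpow : ∀ (t : E) (n : ℤ), Valued.v (jE t) = Valued.v (jE ϖ) ^ n ↔ Valued.v t = Valued.v ϖ ^ n)
        (_hEval : ∀ c : M, ρ c = c → c ≠ 0 → Valued.v c ≤ 1 → ∃ n : ℕ, Valued.v c = Valued.v (jE ϖ) ^ n)
        (_hϖmax : ∀ t : M, ρ t = t → Valued.v t < 1 → Valued.v t ≤ Valued.v (jE ϖ))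
        (γ₂ : GL (Fin 2) E) (u : GL (Fin 1) E)
        (_hdet : (γ₂ : Matrix (Fin 2) (Fin 2) E).det * σ (γ₂ : Matrix (Fin 2) (Fin 2) E).det = 1)
        (_htr : (γ₂ : Matrix (Fin 2) (Fin 2) E).trace = (γ₂ : Matrix (Fin 2) (Fin 2) E).det * σ (γ₂ : Matrix (Fin 2) (Fin 2) E).trace)
        (_hirr : ∀ x : E, x * x - (γ₂ : Matrix (Fin 2) (Fin 2) E).trace * x + (γ₂ : Matrix (Fin 2) (Fin 2) E).det ≠ 0)
        (_hlam2 : lam * lam = jE (γ₂ : Matrix (Fin 2) (Fin 2) E).trace * lam - jE (γ₂ : Matrix (Fin 2) (Fin 2) E).det)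
        (_hρlam : ρ lam = jE (γ₂ : Matrix (Fin 2) (Fin 2) E).trace - lam) (m jl : ℕ) (_hm : Valued.v (lam - jE ((u : Matrix (Fin 1) (Fin 1) E) 0 0)) = WithZero.exp (-(m : ℤ)))
        (_hjl : Valued.v ((lam - jE ((u : Matrix (Fin 1) (Fin 1) E) 0 0)) - ρ (lam - jE ((u : Matrix (Fin 1) (Fin 1) E) 0 0))) = WithZero.exp (-(jl : ℤ)))
        (_hs : Valued.v ((γ₂ : Matrix (Fin 2) (Fin 2) E).trace - 2) * Valued.v (ϖ ^ (d % 2)) ≤ Valued.v (ϖ ^ mcOfRecord d))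
        (_hp : Valued.v ((γ₂ : Matrix (Fin 2) (Fin 2) E).det - (γ₂ : Matrix (Fin 2) (Fin 2) E).trace + 1) ≤ Valued.v (ϖ ^ mcOfRecord d))
        (_hNm : N d tE ≤ m) (_hu1N : Valued.v (((u : Matrix (Fin 1) (Fin 1) E) 0 0) - 1) ≤ Valued.v (ϖ ^ N d tE)) (_hlam1 : Valued.v (lam - 1) ≤ Valued.v (jE ϖ ^ N d tE))
        (_hu : Valued.v ((u : Matrix (Fin 1) (Fin 1) E) 0 0) = 1) (_hum : Valued.v (((u : Matrix (Fin 1) (Fin 1) E) 0 0) - 1) ≤ Valued.v (ϖ ^ mstarOfRecord d))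
        (H₂ : Matrix (Fin 2) (Fin 2) E) (hW : E) (_hH₂ : IsUnit H₂.det) (_hH₂σ : (H₂.map σ)ᵀ = H₂) (_hhW : Valued.v hW = 1) (_hhWσ : σ hW = hW)
        (P₁ : GL (Fin 3) E) (_hA : formCongr σ P₁ ((StdForm.antidiagonal 3).over E) = (!![H₂ 0 0, 0, H₂ 0 1; 0, hW, 0; H₂ 1 0, 0, H₂ 1 1] : Matrix (Fin 3) (Fin 3) E))
        (_hΓ : P₁ * endoGL (γ₂, u) * P₁⁻¹ ∈ unitaryGroupOfForm σ ((StdForm.antidiagonal 3).over E))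
        (φ : (Fin 2 → E) →+ M) (h : M) (_hφs : ∀ (c : E) (x : Fin 2 → E), φ (c • x) = jE c * φ x) (_hφi : Function.Injective φ) (_hφo : Function.Surjective φ)
        (_hφγ : ∀ x, φ ((γ₂ : Matrix (Fin 2) (Fin 2) E).mulVec x) = lam * φ x)
        (_hform : ∀ x y, jE (pairing σ H₂ x y) = h * Θ (φ x) * φ y + ρ (h * Θ (φ x) * φ y)) (_hΘh : Θ h = h) (_hh : h ≠ 0)
        (J R : ℕ) (f : ℕ → ℕ → AddSubgroup M → ℕ)
        (_hfinF : {L₃ : Submodule 𝒪[E] (Fin 3 → E) | IsSelfDualLattice σ ϖ (!![H₂ 0 0, 0, H₂ 0 1; 0, hW, 0; H₂ 1 0, 0, H₂ 1 1] : Matrix (Fin 3) (Fin 3) E) L₃ ∧ mapGL (endoGL (γ₂, u)) L₃ = L₃}.Finite)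
        (_hR : ∀ L₃ : Submodule 𝒪[E] (Fin 3 → E), IsSelfDualLattice σ ϖ (!![H₂ 0 0, 0, H₂ 0 1; 0, hW, 0; H₂ 1 0, 0, H₂ 1 1] : Matrix (Fin 3) (Fin 3) E) L₃ →
          mapGL (endoGL (γ₂, u)) L₃ = L₃ → ∀ b : ℕ, (∀ c : E, (Pi.single 1 c : Fin 3 → E) ∈ L₃ ↔ Valued.v c ≤ Valued.v ϖ ^ b) → b ≤ R)
        (_hJ : ¬ IsOrd ρ α (jE ϖ ^ (J + 1)) lam) (_hfinLS : ∀ j a, (levelSet ρ Θ α (jE ϖ) h j a).Finite)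
        (_hf : ∀ (b j : ℕ) (Λ : AddSubgroup M) (x₀ : M) (r : E), 1 ≤ b → x₀ ≠ 0 → (∀ x, x ∈ Λ ↔ ∃ z, IsOrd ρ α (jE ϖ ^ j) z ∧ x = x₀ * z) →
          IsOrd ρ α (jE ϖ ^ j) (dualGen ρ Θ α (jE ϖ ^ j) h x₀) → ¬ IsOrd ρ α (jE ϖ ^ j) (dualGen ρ Θ α (jE ϖ ^ j) h x₀ / jE ϖ) → Valued.v (dualGen ρ Θ α (jE ϖ ^ j) h x₀) = Valued.v (jE ϖ) ^ b →
          (∀ b', (∀ x ∈ Λ, Valued.v (h * Θ x * b' + ρ (h * Θ x * b')) ≤ 1) → (lam - jE ((u : Matrix (Fin 1) (Fin 1) E) 0 0)) * b' ∈ Λ) → IsOrd ρ α (jE ϖ ^ j) lam →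
          jE r = glueUnit ρ Θ α (jE ϖ ^ j) h (jE ϖ) (jE hW) x₀ b →
          f b j Λ = Nat.card {x : 𝒪[E] ⧸ 𝓂[E] ^ (2 * b) // ∃ u' : 𝒪[E], Ideal.Quotient.mk (𝓂[E] ^ (2 * b)) u' = x ∧ Valued.v ((u' : E) * σ u' - r) ≤ Valued.v (ϖ ^ (2 * b))}),
        ∀ j b : ℕ, 1 ≤ b → b ≤ j → d % 2 = 1 → m = 4 * b → jl = 2 * j + dρ + 2 * b → (j + 1 = b + s0 ∨ (b + s0 ≤ j ∧ (j - b - s0) % 2 = 0)) → IsOrd ρ α (jE ϖ ^ j) lam →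
                ((∑ᶠ Λ ∈ levelSetDep ρ Θ α (jE ϖ) h j b (lam - jE ((u : Matrix (Fin 1) (Fin 1) E) 0 0)) ∩
                      {Λ | ∃ B : Submodule 𝒪[E] (Fin 2 → E), B.toAddSubgroup.map φ = Λ ∧
                        ∃ L₃ : Submodule 𝒪[E] (Fin 3 → E), IsSelfDualLattice σ ϖ (!![H₂ 0 0, 0, H₂ 0 1; 0, hW, 0; H₂ 1 0, 0, H₂ 1 1] : Matrix (Fin 3) (Fin 3) E) L₃ ∧
                          L₃ ⊓ LinearMap.ker ((LinearMap.proj (1 : Fin 3) : (Fin 3 → E) →ₗ[E] E).restrictScalars 𝒪[E]) =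
                            B.map ((Matrix.toLin' (!![1, 0; 0, 0; 0, 1] : Matrix (Fin 3) (Fin 2) E)).restrictScalars 𝒪[E]) ∧
                          (∀ c : E, (Pi.single 1 c : Fin 3 → E) ∈ L₃ ↔ Valued.v c ≤ Valued.v ϖ ^ b) ∧
                          (LatticeNearTransvShell ϖ (d % 2) (mstarOfRecord d) ((((endoGL (γ₂, u) : GL (Fin 3) E) : Matrix (Fin 3) (Fin 3) E) - 1)) L₃ ∧
                            {z : E | ∃ y ∈ L₃, Valued.v ((ϖ ^ (mstarOfRecord d))⁻¹ * (z - pairing σ (!![H₂ 0 0, 0, H₂ 0 1; 0, hW, 0; H₂ 1 0, 0, H₂ 1 1] : Matrix (Fin 3) (Fin 3) E) y (((((endoGL (γ₂, u) : GL (Fin 3) E) : Matrix (Fin 3) (Fin 3) E) - 1)) *ᵥ y))) ≤ 1} =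
                              valueSetMod σ ϖ (mstarOfRecord d) (xPlus σ ϖ d))}, f b j Λ : ℕ) : ℤ) -
                  ((∑ᶠ Λ ∈ levelSetDep ρ Θ α (jE ϖ) h j b (lam - jE ((u : Matrix (Fin 1) (Fin 1) E) 0 0)) ∩
                      {Λ | ∃ B : Submodule 𝒪[E] (Fin 2 → E), B.toAddSubgroup.map φ = Λ ∧
                        ∃ L₃ : Submodule 𝒪[E] (Fin 3 → E), IsSelfDualLattice σ ϖ (!![H₂ 0 0, 0, H₂ 0 1; 0, hW, 0; H₂ 1 0, 0, H₂ 1 1] : Matrix (Fin 3) (Fin 3) E) L₃ ∧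
                          L₃ ⊓ LinearMap.ker ((LinearMap.proj (1 : Fin 3) : (Fin 3 → E) →ₗ[E] E).restrictScalars 𝒪[E]) =
                            B.map ((Matrix.toLin' (!![1, 0; 0, 0; 0, 1] : Matrix (Fin 3) (Fin 2) E)).restrictScalars 𝒪[E]) ∧
                          (∀ c : E, (Pi.single 1 c : Fin 3 → E) ∈ L₃ ↔ Valued.v c ≤ Valued.v ϖ ^ b) ∧
                          (LatticeNearTransvShell ϖ (d % 2) (mcOfRecord d) ((((endoGL (γ₂, u) : GL (Fin 3) E) : Matrix (Fin 3) (Fin 3) E) - 1)) L₃ ∧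
                            ¬ {z : E | ∃ y ∈ L₃, Valued.v ((ϖ ^ (mstarOfRecord d))⁻¹ * (z - pairing σ (!![H₂ 0 0, 0, H₂ 0 1; 0, hW, 0; H₂ 1 0, 0, H₂ 1 1] : Matrix (Fin 3) (Fin 3) E) y (((((endoGL (γ₂, u) : GL (Fin 3) E) : Matrix (Fin 3) (Fin 3) E) - 1)) *ᵥ y))) ≤ 1} =
                              valueSetMod σ ϖ (mstarOfRecord d) (xPlus σ ϖ d))}, f b j Λ : ℕ) : ℤ) = 0 := by
  intro E M _ _ _ _ _ _ _ _ _ _ σ ϖ d tE _hD _hσσ _h2 jE ρ Θ α lam _hρρ _hvρ _hρj _hjv _hjfix _hΘj _hΘΘ _hΘρ _hvΘ _hα _hα1 _hint _hΘlam _hvlam _hbasis _hC ϖM c₀ n₀ dρ dΘ dτ g s0 dK d' _c1 _c2 _c3 _c4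
    _c5 _c6 _c7 _c8 _c9 _c10 _c11 _c12 _c13 _c14 _c15 _c16 _c17 _c18 _c19 _c20 _c21 _c22 _c23 _c24 _c25 _c26 _c27 _c28 _c29 _hjpow _hEval _hϖmax γ₂ u _hdet _htr _hirr _hlam2 _hρlam m jl _hm _hjl _hs _hp
    _hNm _hu1N _hlam1 _hu _hum H₂ hW _hH₂ _hH₂σ _hhW _hhWσ P₁ _hA _hΓ φ h _hφs _hφi _hφo _hφγ _hform _hΘh _hh J R f _hfinF _hR _hJ _hfinLS _hf j b hb1 hbj hd1 hmb hjlb hlive hord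
  rcases le_or_gt (mstarOfRecord d) b with hray | hmix
  · exact hC_ray E M σ ϖ d tE _hD _hσσ _h2 jE ρ Θ α lam _hρρ _hvρ _hρj _hjv _hjfix _hΘj _hΘΘ _hΘρ _hvΘ _hα _hα1 _hint _hΘlam _hvlam _hbasis _hC ϖM c₀ n₀ dρ dΘ dτ g s0 dK d' _c1 _c2 _c3 _c4 _c5 _c6 _c7 _c8
      _c9 _c10 _c11 _c12 _c13 _c14 _c15 _c16 _c17 _c18 _c19 _c20 _c21 _c22 _c23 _c24 _c25 _c26 _c27 _c28 _c29 _hjpow _hEval _hϖmax γ₂ u _hdet _htr _hirr _hlam2 _hρlam m jl _hm _hjl _hs _hp _hNm _hu1N _hlam1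
      _hu _hum H₂ hW _hH₂ _hH₂σ _hhW _hhWσ P₁ _hA _hΓ φ h _hφs _hφi _hφo _hφγ _hform _hΘh _hh J R f _hfinF _hR _hJ _hfinLS _hf j b hb1 hbj hd1 hmb hjlb hlive hray hord
  · exact hC_mix E M σ ϖ d tE _hD _hσσ _h2 jE ρ Θ α lam _hρρ _hvρ _hρj _hjv _hjfix _hΘj _hΘΘ _hΘρ _hvΘ _hα _hα1 _hint _hΘlam _hvlam _hbasis _hC ϖM c₀ n₀ dρ dΘ dτ g s0 dK d' _c1 _c2 _c3 _c4 _c5 _c6 _c7 _c8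
      _c9 _c10 _c11 _c12 _c13 _c14 _c15 _c16 _c17 _c18 _c19 _c20 _c21 _c22 _c23 _c24 _c25 _c26 _c27 _c28 _c29 _hjpow _hEval _hϖmax γ₂ u _hdet _htr _hirr _hlam2 _hρlam m jl _hm _hjl _hs _hp _hNm _hu1N _hlam1
      _hu _hum H₂ hW _hH₂ _hH₂σ _hhW _hhWσ P₁ _hA _hΓ φ h _hφs _hφi _hφo _hφγ _hform _hΘh _hh J R f _hfinF _hR _hJ _hfinLS _hf j b hb1 hbj hd1 hmb hjlb hlive hmix hord

end Summit.HodgeConjecture.HodgeConjecture.Cruxes.H413.F0P3cDyRamBeta2ConesOffRowCCornerOfBands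

end
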